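import Mathlib
import HarnessLib
import Summits.HubbardSuperconductivity.HubbardSuperconductivity.Theorems.KLProgrammeKLRegimeEngineTwoShellLatticeCount

/-!
# Route `KLProgramme` — ENGINE (stmt-HubbardSuperconductivity-20437 `KLRegimeEngineV17F2`), cure (C′) of located #22, brick O3 part 1:
# the LOWER half of the lattice ↔ volume comparison — a set COVERED by the cells of a family of torus momenta has volume `≤ #·(2π/L)²`,
# and the cells of ALL torus momenta cover the square `[0, 2π)²`
# (cell gate-hubbard-kl, seat hubbard-kl-k3c2-p2 g30, technique «thermal-bar induction n ≤ nScales β + 1 with EngineBoundsAtV4S sums»)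

WHY.  `…EngineTwoShellLatticeCount` §1 (`card_mul_le_volume_of_cells`, FST II App. B) bounds a lattice count FROM ABOVE by the volume of a set containing
the counted cells.  The two-sided shell ASYMMETRY of cure (C′)'s brick O3 (`#{t < e_K ≤ Λ} − #{−Λ ≤ e_K < −t}`, design note
`HOME/hubbard-kl-k3c2-p2/g30/CURE-C-PRIME-DESIGN.md` §3) needs BOTH directions for each one-sided count.  This file is the lower direction:

* `volume_biUnion_cells_le` — `vol(⋃_{k ∈ P} cell k) ≤ #P·(2π/L)²` (subadditivity; cell = `p_k̃ + [0, 2π/L)²` as in §1 there);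
* **`volume_le_card_mul_of_subset_cells`** — if `T ⊆ ⋃_{k ∈ P} cell k` then `vol T ≤ #P·(2π/L)²`;
* `exists_mem_cell_of_mem_square` — every point of `[0, 2π)²` lies in the cell of some torus momentum (`k̃_i = ⌊q_i·L/(2π)⌋`);
* **`volume_le_card_filter_mul_of_thin`** — for `T ⊆ [0, 2π)²`: if every torus momentum whose cell meets `T` satisfies a predicate `p`, then
  `vol T ≤ #{k̃ : p k̃}·(2π/L)²` — the form the asymmetry brick consumes (with `p k̃ := «p_k̃ ∈ the shell fattened by G·2π/L»`, `T` = the thinned shell).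
Pure measure theory / floor arithmetic; nothing about the model; nothing asserts (c), K3 or superconductivity.  [cite: FeldmanSalmhoferTrubowitz1998, App. B]
-/

noncomputable section

namespace Summit.HubbardSuperconductivity.HubbardSuperconductivity.Theorems.EngineV8

set_option linter.dupNamespace false -- summit = problem name (single-conjunct summit), D-0017

open Real Set MeasureTheory Finset
open scoped ENNReal
open Literature.MathematicalPhysics.QuantumLattice Literature.Probability.LatticeModels

/-! ## §1 Volume of a union of cells, and of a set covered by cells -/

/-- The volume of the cell `p_k̃ + [0, 2π/L)²` is `(2π/L)²`. -/
theorem volume_cell_eq {L : ℕ} [NeZero L] (k : TorusSite 2 L) :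
    volume (Ico (latticeMomentum L k 0) (latticeMomentum L k 0 + 2 * π / L) ×ˢ
      Ico (latticeMomentum L k 1) (latticeMomentum L k 1 + 2 * π / L)) = ENNReal.ofReal ((2 * π / L) ^ 2) := by
  have hL : (0 : ℝ) < L := by exact_mod_cast Nat.pos_of_ne_zero (NeZero.ne L)
  have hh : 0 < 2 * π / L := by positivity
  rw [Measure.volume_eq_prod, Measure.prod_prod, Real.volume_Ico, Real.volume_Ico, add_sub_cancel_left, add_sub_cancel_left,
    ← ENNReal.ofReal_mul hh.le, sq]

/-- **Subadditivity over cells**: `vol(⋃_{k ∈ P} cell k) ≤ #P·(2π/L)²`. -/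
theorem volume_biUnion_cells_le {L : ℕ} [NeZero L] (P : Finset (TorusSite 2 L)) :
    volume (⋃ k ∈ P, Ico (latticeMomentum L k 0) (latticeMomentum L k 0 + 2 * π / L) ×ˢ
      Ico (latticeMomentum L k 1) (latticeMomentum L k 1 + 2 * π / L)) ≤ (P.card : ℝ≥0∞) * ENNReal.ofReal ((2 * π / L) ^ 2) := by
  refine (measure_biUnion_finset_le P _).trans (le_of_eq ?_)
  rw [Finset.sum_congr rfl fun k _ => volume_cell_eq k, Finset.sum_const, nsmul_eq_mul]

/-- **A set covered by cells**: `T ⊆ ⋃_{k ∈ P} cell k ⟹ vol T ≤ #P·(2π/L)²`. -/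
theorem volume_le_card_mul_of_subset_cells {L : ℕ} [NeZero L] (P : Finset (TorusSite 2 L)) {T : Set (ℝ × ℝ)}
    (hT : T ⊆ ⋃ k ∈ P, Ico (latticeMomentum L k 0) (latticeMomentum L k 0 + 2 * π / L) ×ˢ
      Ico (latticeMomentum L k 1) (latticeMomentum L k 1 + 2 * π / L)) :
    volume T ≤ (P.card : ℝ≥0∞) * ENNReal.ofReal ((2 * π / L) ^ 2) :=
  (measure_mono hT).trans (volume_biUnion_cells_le P)

/-! ## §2 The cells of all torus momenta cover the square `[0, 2π)²` -/

/-- The floor index of a coordinate `x ∈ [0, 2π)`: `⌊x·L/(2π)⌋ < L`. -/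
theorem floor_index_lt {L : ℕ} [NeZero L] {x : ℝ} (hx0 : 0 ≤ x) (hx : x < 2 * π) : ⌊x * L / (2 * π)⌋₊ < L := by
  have hL : (0 : ℝ) < L := by exact_mod_cast Nat.pos_of_ne_zero (NeZero.ne L)
  have h2π : (0 : ℝ) < 2 * π := by positivity
  have hlt : x * L / (2 * π) < L := by
    rw [div_lt_iff₀ h2π]
    calc x * L < 2 * π * L := by nlinarith
      _ = (L : ℝ) * (2 * π) := by ring
  exact (Nat.floor_lt (by positivity)).mpr hlt

/-- A coordinate `x ∈ [0, 2π)` lies in the dyadic-free cell `[2π k/L, 2π k/L + 2π/L)` of its floor index `k = ⌊x·L/(2π)⌋`. -/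
theorem mem_Ico_floor_index {L : ℕ} [NeZero L] {x : ℝ} (hx0 : 0 ≤ x) :
    x ∈ Ico (2 * π * ((⌊x * L / (2 * π)⌋₊ : ℕ) : ℝ) / L) (2 * π * ((⌊x * L / (2 * π)⌋₊ : ℕ) : ℝ) / L + 2 * π / L) := by
  have hL : (0 : ℝ) < L := by exact_mod_cast Nat.pos_of_ne_zero (NeZero.ne L)
  have h2π : (0 : ℝ) < 2 * π := by positivity
  have hy : 0 ≤ x * L / (2 * π) := by positivity
  have hfl := Nat.floor_le hy
  have hlt := Nat.lt_floor_add_one (x * L / (2 * π))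
  constructor
  · -- `2π⌊y⌋/L ≤ x` from `⌊y⌋ ≤ y = xL/(2π)`
    have : 2 * π * (⌊x * L / (2 * π)⌋₊ : ℝ) ≤ x * L := by
      have := mul_le_mul_of_nonneg_left hfl h2π.le
      rwa [mul_div_cancel₀ _ h2π.ne'] at this
    rw [div_le_iff₀ hL]
    linarith
  · have : x * L < 2 * π * ((⌊x * L / (2 * π)⌋₊ : ℝ) + 1) := by
      have := mul_lt_mul_of_pos_left hlt h2π
      rwa [mul_div_cancel₀ _ h2π.ne'] at this
    rw [← add_div, lt_div_iff₀ hL]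
    linarith

/-- **Cover**: every point of the square `[0, 2π)²` lies in the cell of some torus momentum. -/
theorem exists_mem_cell_of_mem_square {L : ℕ} [NeZero L] {q : ℝ × ℝ} (hq : q ∈ Ico (0 : ℝ) (2 * π) ×ˢ Ico (0 : ℝ) (2 * π)) :
    ∃ k : TorusSite 2 L, q ∈ Ico (latticeMomentum L k 0) (latticeMomentum L k 0 + 2 * π / L) ×ˢ
      Ico (latticeMomentum L k 1) (latticeMomentum L k 1 + 2 * π / L) := by
  obtain ⟨⟨h10, h1⟩, ⟨h20, h2⟩⟩ := hq
  refine ⟨![((⌊q.1 * L / (2 * π)⌋₊ : ℕ) : ZMod L), ((⌊q.2 * L / (2 * π)⌋₊ : ℕ) : ZMod L)], ?_⟩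
  have hv1 : (((⌊q.1 * L / (2 * π)⌋₊ : ℕ) : ZMod L)).val = ⌊q.1 * L / (2 * π)⌋₊ := ZMod.val_natCast_of_lt (floor_index_lt h10 h1)
  have hv2 : (((⌊q.2 * L / (2 * π)⌋₊ : ℕ) : ZMod L)).val = ⌊q.2 * L / (2 * π)⌋₊ := ZMod.val_natCast_of_lt (floor_index_lt h20 h2)
  simp only [mem_prod, latticeMomentum, Matrix.cons_val_zero, Matrix.cons_val_one, Matrix.cons_val_fin_one, hv1, hv2]
  exact ⟨mem_Ico_floor_index h10, mem_Ico_floor_index h20⟩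

/-- **Thin-set form of the lower count bound**: `T ⊆ [0, 2π)²`, and every torus momentum whose cell meets `T` satisfies `p` ⟹
`vol T ≤ #{k̃ : p k̃}·(2π/L)²`. -/
theorem volume_le_card_filter_mul_of_thin {L : ℕ} [NeZero L] (p : TorusSite 2 L → Prop) [DecidablePred p] {T : Set (ℝ × ℝ)}
    (hT : T ⊆ Ico (0 : ℝ) (2 * π) ×ˢ Ico (0 : ℝ) (2 * π))
    (hp : ∀ k : TorusSite 2 L, ∀ q ∈ T, q ∈ Ico (latticeMomentum L k 0) (latticeMomentum L k 0 + 2 * π / L) ×ˢ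
      Ico (latticeMomentum L k 1) (latticeMomentum L k 1 + 2 * π / L) → p k) :
    volume T ≤ ((univ.filter p).card : ℝ≥0∞) * ENNReal.ofReal ((2 * π / L) ^ 2) := by
  refine volume_le_card_mul_of_subset_cells (univ.filter p) fun q hq => ?_
  obtain ⟨k, hk⟩ := exists_mem_cell_of_mem_square (L := L) (hT hq)
  exact Set.mem_biUnion (Finset.mem_coe.mpr (Finset.mem_filter.mpr ⟨Finset.mem_univ _, hp k q hq hk⟩)) hk

end Summit.HubbardSuperconductivity.HubbardSuperconductivity.Theorems.EngineV8

end
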